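import Summits.BirchSwinnertonDyer.BirchSwinnertonDyer.Theorems.ErratumRoadFiveNonSurjCornerFiveInstanceEstar
import HarnessLib

/-!
# Route `ErratumRoadFive` (rung K2), crux `NonSurjCorner` (item stmt-BirchSwinnertonDyer-19065), gen-3 DEEP children
# 23046 `NonSurjCornerKolyZDeep` ∕ 23047 `NonSurjCornerTwinMuAnDeep`: NEW DEEP CORNER PAIRS AT `p = 5` BEYOND THE CENSUS BOX AS KERNEL INSTANCES,
# PART E: `J9t-16o5d269` (`t = -16/5`, `d = 269`) and `J9t-64o155d17` (`t = -64/155`, `d = 17`)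
# (cell `bsd-stepL`, seat `bsd-stepL-corner5-p2` g15, WIDTH-LEVER lane B; `--supports stmt-BirchSwinnertonDyer-23047 --as helper`)

WHY ∕ METHOD: as in parts A ∕ B (p721960 ∕ p722003; template `…FiveInstanceEstar`). Lane B g15's deep hunt, THIRD band (kit j332850: ALL 9 371 root-number −1
members of Zywina's `X_{G₉}` family `j = J₉(t)`, `t = a/b`, `5 ∣ b`, `|a| ≤ 400`, `b ≤ 200`, twists `|d| ≤ 300`, with `10¹² < N ≤ 4·10¹²`; per pair `ellrank` effort 2 → saturation →
ĥ, `ellL1` → `L'(E,1)`, `#Ш_an = X∕ĥ`): 9 029 corner pairs, 6 072 decided, and TEN with `#Ш_an = 25`, each re-verified at 38 digits by kit j333674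
(`ellanalyticrank` = 1 with `L'` = `ellL1` = `lfun`; `ellrank` = `[1, 1, 0]` — rank EXACTLY 1 by 2-descent; generator saturated at every prime ≤ 500; `#Ш_an = 25.000…`).
THIS FILE (part E): the pairs `J9t-16o5d269` and `J9t-64o155d17` as BY-NAME kernel instances — every ALGEBRAIC hypothesis of the deep children decided in the kernel from the literal integer model
(discriminant and `c₄` with factorisations, global minimality by Silverman's bounded criterion — Kraus at `2` where `2¹² ∣ Δ` —, multiplicative reduction at `5` with
`5 ∣ ord₅ Δ_min`, irreducibility of `E[5]` by a Frobenius no-root witness, the multiplicative primes, hence no (ram) witness), `ρ̄_{E,5}` NOT onto a THEOREM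
(`j(E) = J₉(t)`, the tree's `zywina2015_thm14_not_surjective_five_of_j_eq_J9_holds`), the two ANALYTIC hypotheses (`r_an = 1`, `0 < ord₅ #Ш_an`) displayed binders
`hr`, `hSha` in `deepHypotheses` ∕ `twinMuAnDeep_at`.
* `J9t-16o5d269` (namespace `Tm16o5d269`): `t = -16/5`, `[0, 1, 1, -160014291, -1241748681899]`, `N = 3980755532645 = 5·31²·107²·269²`, `ord₅ Δ_min = 5` — `5` the only multiplicative prime; numerics `L'(E,1) = 18.4386062…`, `ĥ = 9.00987811…`, `X = 225.2469529…`, `#Ш_an = 25.0000…`; first Heegner fields `d_K = -24, -84, -339, -471, …`.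
* `J9t-64o155d17` (namespace `Tm64o155d17`): `t = -64/155`, `[0, -1, 1, -88192781, -8097218415888]`, `N = 1625007116555 = 5·17²·19²·31·317²`, `ord₅ Δ_min = 5` — a second multiplicative prime `31` with `ord Δ_min = 5` (divisible by 5: no (ram) witness); numerics `L'(E,1) = 12.0083108…`, `ĥ = 28.6660453…`, `X = 716.6511339…`, `#Ш_an = 25.0000…`; first Heegner fields `d_K = -179, -259, -356, -611, …`.

HONEST FRAMING: theorems about explicit curves only; no definition, no named fact, no `sorry`; CONDITIONAL only on the displayed analytic binders where they appear;
nothing is booked; 23046 ∕ 23047 ∕ 19065 stay OPEN (class-wide: Kolyvagin's refined conjecture ∕ Greenberg's Conj. 1.11 at a non-surjective irreducible image with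
`p ∥ N`); BSD is proved for no curve; no census word, tier or label moves (T7). Memo `HOME/corner5/g15/CORNER5-P2-G15.md`; data `HOME/corner5/g15/data/hunt5/`
(HUNT5-P3-N4e12.census.tsv), `…/verify10/`. References: as in part A. -/

set_option linter.dupNamespace false
set_option autoImplicit false

noncomputable section
open scoped Classical
open WeierstrassCurve Literature.NumberTheory.EllipticCurves
  Literature.NumberTheory.EllipticCurves.Rank1Residual
  Literature.NumberTheory.EllipticCurves.Rank1Residual.X11RankOneCertificates
  Summit.BirchSwinnertonDyer.BirchSwinnertonDyer.Rank1Residual.IntModel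
  Summit.BirchSwinnertonDyer.Rank1Residual Summit.BirchSwinnertonDyer.Rank1Residual.X11b

namespace Summit.BirchSwinnertonDyer.BirchSwinnertonDyer.Theorems.CornerFive

/-! ## Kernel pair facts of `E₀ = [0, 1, 1, -160014291, -1241748681899]` (`J9t-16o5d269`, `j = J₉(-16/5)`, `N = 3980755532645 = 5·31²·107²·269²`) at `p = 5` -/

namespace Tm16o5d269

/-- `Δ(E₀) = -403846514149597807987746875`. [cite: SilvermanAEC2009, III.1] -/
theorem Δ_eq : (⟨0, 1, 1, -160014291, -1241748681899⟩ : WeierstrassCurve ℤ).Δ = -403846514149597807987746875 := by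
  decide

/-- `Δ(E₀) = -5⁵·31³·107²·269⁶` (bad primes `5, 31, 107, 269`; `N = 5·31²·107²·269²`). [cite: SilvermanAEC2009, VII.5 Prop. 5.1] -/
theorem Δ_eq_factored : (⟨0, 1, 1, -160014291, -1241748681899⟩ : WeierstrassCurve ℤ).Δ =
    -(5 ^ 5 * 31 ^ 3 * 107 ^ 2 * 269 ^ 6) := by
  rw [Δ_eq]; norm_num

/-- `c₄(E₀) = 7680685984 = 2⁵·31·107·269²`. [cite: SilvermanAEC2009, III.1] -/
theorem c₄_eq : (⟨0, 1, 1, -160014291, -1241748681899⟩ : WeierstrassCurve ℤ).c₄ = 7680685984 := by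
  decide

/-- `#Ẽ₀(𝔽_2) = 3` (`a_2 = 0`), kernel-decided. [cite: SilvermanAEC2009, V.2] -/
theorem card_F2 : Nat.card (((⟨0, 1, 1, -160014291, -1241748681899⟩ : WeierstrassCurve ℤ).map
    (Int.castRingHom (ZMod 2))).toAffine.Point) = 3 := by
  rw [@natCard_point_eq_one_add_card (ZMod 2) (@ZMod.instField 2 ⟨by norm_num⟩) _ _ _ (by decide)]
  decide

/-- `E` is an elliptic curve (`Δ ≠ 0`). [cite: SilvermanAEC2009, III.1] -/
theorem isElliptic (W : WeierstrassCurve ℚ) (hW : W = ⟨0, 1, 1, -160014291, -1241748681899⟩) : W.IsElliptic := by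
  subst hW; exact isElliptic_of_discOf_ne_zero 0 1 1 (-160014291) (-1241748681899) (by decide +kernel)

/-- The model is GLOBALLY MINIMAL: `|Δ| < 256¹²` and `q¹² ∤ Δ` for every prime `q < 256` (all `ord_q Δ ≤ 6`).
[cite: SilvermanAEC2009, VII.1 Remark 1.1] -/
theorem isGloballyMinimal (W : WeierstrassCurve ℚ) (hW : W = ⟨0, 1, 1, -160014291, -1241748681899⟩) : W.IsGloballyMinimal := by
  subst hW
  exact CornerSeven.isGloballyMinimal_of_silverman_bounded 0 1 1 (-160014291) (-1241748681899) 256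
    (by decide +kernel) (by decide +kernel) (by decide +kernel)

/-- The tree's integral model of `E` is `E₀`. [folklore] -/
theorem integralModelInt_eq (W : WeierstrassCurve ℚ) (hW : W = ⟨0, 1, 1, -160014291, -1241748681899⟩) [W.IsGloballyMinimal] :
    integralModelInt W = ⟨0, 1, 1, -160014291, -1241748681899⟩ := by
  subst hW; exact integralModelInt_eq_of_map_eq _ (map_mk_int _ _ _ _ _)

/-- `E` as the base change of its integer model. [folklore] -/
theorem eq_baseChange (W : WeierstrassCurve ℚ) (hW : W = ⟨0, 1, 1, -160014291, -1241748681899⟩) :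
    W = (⟨0, 1, 1, -160014291, -1241748681899⟩ : WeierstrassCurve ℤ).baseChange ℚ := by
  rw [hW]; ext <;> simp [WeierstrassCurve.baseChange, WeierstrassCurve.map]

/-- **Multiplicative reduction at `5`** (`5 ∣ Δ`, `5 ∤ c₄`). [cite: SilvermanAEC2009, VII.5 Prop. 5.1(b)] -/
theorem mult_five (W : WeierstrassCurve ℚ) (hW : W = ⟨0, 1, 1, -160014291, -1241748681899⟩) [W.IsElliptic] [W.IsGloballyMinimal]
    [Fact (Nat.Prime 5)] : Mult W 5 :=
  hasMultiplicativeReductionAtPrime_of_intModel (integralModelInt_eq W hW) 5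
    (by rw [Δ_eq]; decide) (by rw [c₄_eq]; decide)

/-- `ord₅ Δ_min(E) = 5`. [cite: SilvermanAEC2009, VII.5 Prop. 5.1(b)] -/
theorem padicValInt_five (W : WeierstrassCurve ℚ) (hW : W = ⟨0, 1, 1, -160014291, -1241748681899⟩) [W.IsElliptic] [W.IsGloballyMinimal]
    [Fact (Nat.Prime 5)] : padicValInt 5 W.minimalDiscriminantInt = 5 := by
  rw [minimalDiscriminantInt_eq (integralModelInt_eq W hW), Δ_eq]
  exact padicValInt_eq_of_dvd_of_not_dvd 5 (by decide) (by decide)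

/-- The crux binder **`5 ∣ ord₅ Δ_min(E)`** (`5 = 5·1`). [cite: SilvermanAEC2009, VII.5 Prop. 5.1(b)] -/
theorem dvd_padicValInt_five (W : WeierstrassCurve ℚ) (hW : W = ⟨0, 1, 1, -160014291, -1241748681899⟩) [W.IsElliptic] [W.IsGloballyMinimal]
    [Fact (Nat.Prime 5)] : (5 : ℕ) ∣ padicValInt 5 W.minimalDiscriminantInt := by
  have h := padicValInt_five W hW
  omega

/-- **`E[5]` is irreducible**: Frobenius no-root witness at the good prime `ℓ = 2` (`a₂ = 0`, `X² + 2` root-free mod `5`;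
Mazur 1978 Prop. 6.3 (1)). [cite: Mazur1978, §6 Prop. 6.3 (1) (p. 153)] -/
theorem irr_five (W : WeierstrassCurve ℚ) (hW : W = ⟨0, 1, 1, -160014291, -1241748681899⟩) [W.IsElliptic] [W.IsGloballyMinimal]
    [Fact (Nat.Prime 5)] : Irr W 5 :=
  haveI : Fact (Nat.Prime 2) := ⟨by norm_num⟩
  hasIrreducibleModPGaloisRep_of_intModel_of_noroot (integralModelInt_eq W hW) 5 2
    (by decide) (by rw [Δ_eq]; decide) card_F2
    (of_decide_eq_true rfl)

/-- **Every prime of multiplicative reduction of `E` is `5`**: it divides `Δ = -5⁵·31³·107²·269⁶`, and `31`, `107`, `269` are additive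
(`q ∣ Δ`, `q ∣ c₄` at the globally minimal model). [cite: SilvermanAEC2009, VII.5 Prop. 5.1] -/
theorem eq_five_of_mult (W : WeierstrassCurve ℚ) (hW : W = ⟨0, 1, 1, -160014291, -1241748681899⟩) [W.IsElliptic] [W.IsGloballyMinimal]
    {ℓ : ℕ} [hℓ : Fact ℓ.Prime] (hm : Mult W ℓ) : ℓ = 5 := by
  have hI := integralModelInt_eq W hW
  have hdvd : (ℓ : ℤ) ∣ (⟨0, 1, 1, -160014291, -1241748681899⟩ : WeierstrassCurve ℤ).Δ := by
    by_contra hnd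
    exact (hasGoodReductionAtPrime_of_not_dvd W ℓ (by rwa [minimalDiscriminantInt_eq hI])).not_hasMultiplicativeReduction _ hm
  rw [Δ_eq_factored, Int.dvd_neg, Int.natCast_dvd] at hdvd
  simp only [Int.natAbs_mul, Int.natAbs_pow] at hdvd
  have hp := hℓ.out
  have hadd : ∀ q : ℕ, [Fact q.Prime] → (q : ℤ) ∣ (⟨0, 1, 1, -160014291, -1241748681899⟩ : WeierstrassCurve ℤ).Δ →
      (q : ℤ) ∣ (⟨0, 1, 1, -160014291, -1241748681899⟩ : WeierstrassCurve ℤ).c₄ → ¬ Mult W q :=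
    fun q _ hΔ hc ↦ not_hasMultiplicativeReductionAtPrime_of_intModel_of_dvd_of_dvd hI q hΔ hc
  rcases (Nat.Prime.dvd_mul hp).mp hdvd with hdvd | h269
  · rcases (Nat.Prime.dvd_mul hp).mp hdvd with hdvd | h107
    · rcases (Nat.Prime.dvd_mul hp).mp hdvd with hdvd | h31
      · exact (Nat.prime_dvd_prime_iff_eq hp (by norm_num : Nat.Prime 5)).mp (hp.dvd_of_dvd_pow hdvd)
      · exfalso
        have h' : ℓ = 31 := (Nat.prime_dvd_prime_iff_eq hp (by norm_num : Nat.Prime 31)).mp (hp.dvd_of_dvd_pow h31)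
        subst h'
        exact hadd 31 (by rw [Δ_eq]; decide) (by rw [c₄_eq]; decide) hm
    · exfalso
      have h' : ℓ = 107 := (Nat.prime_dvd_prime_iff_eq hp (by norm_num : Nat.Prime 107)).mp (hp.dvd_of_dvd_pow h107)
      subst h'
      exact hadd 107 (by rw [Δ_eq]; decide) (by rw [c₄_eq]; decide) hm
  · exfalso
    have h' : ℓ = 269 := (Nat.prime_dvd_prime_iff_eq hp (by norm_num : Nat.Prime 269)).mp (hp.dvd_of_dvd_pow h269)
    subst h'
    exact hadd 269 (by rw [Δ_eq]; decide) (by rw [c₄_eq]; decide) hm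

/-- The crux binder **no (ram) witness at `5`**: `E` has no multiplicative prime other than `5`.
[cite: SkinnerUrban2014, Thm. 2 (p. 3), hypothesis (ram)] -/
theorem not_ram_five (W : WeierstrassCurve ℚ) (hW : W = ⟨0, 1, 1, -160014291, -1241748681899⟩) [W.IsElliptic] [W.IsGloballyMinimal]
    [Fact (Nat.Prime 5)] : ¬ Ram W 5 := by
  rintro ⟨ℓ, hℓ, hne, hm, -⟩
  exact hne (eq_five_of_mult W hW hm)

/-- **`j(E) = J₉(-16/5)`** on Zywina's `X_{G₉}` j-line: `j = c₄³/Δ = −3506176/3125 = t³(t² + 5t + 40)` at `t = -16/5`.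
[cite: Zywina2015, §1.3 (J₉) and Thm. 1.4 (arXiv:1508.07660)] -/
theorem j_eq_J9 (W : WeierstrassCurve ℚ) (hW : W = ⟨0, 1, 1, -160014291, -1241748681899⟩) [W.IsElliptic] :
    W.j = (-16 / 5 : ℚ) ^ 3 * ((-16 / 5 : ℚ) ^ 2 + 5 * (-16 / 5) + 40) := by
  have hW' := eq_baseChange W hW
  subst hW'
  rw [j_baseChange_int, c₄_eq, Δ_eq]; norm_num

/-- **`ρ̄_{E,5}` is NOT onto** — a THEOREM: `E` is non-CM (multiplicative at `5`) and `j(E) = J₉(-16/5)`, so the tree's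
`zywina2015_thm14_not_surjective_five_of_j_eq_J9_holds` applies. [cite: Zywina2015, Thm. 1.4 (i = 9) (arXiv:1508.07660)]
[cite: SilvermanATAEC1994, Thm. II.6.4] -/
theorem not_surj_five (W : WeierstrassCurve ℚ) (hW : W = ⟨0, 1, 1, -160014291, -1241748681899⟩) [W.IsElliptic] [W.IsGloballyMinimal]
    [Fact (Nat.Prime 5)] : ¬ Surj W 5 :=
  zywina2015_thm14_not_surjective_five_of_j_eq_J9_holds W
    (fun hCM ↦ not_hasMultiplicativeReductionAtPrime_of_hasCM W hCM 5 (mult_five W hW)) (-16 / 5) (j_eq_J9 W hW)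

/-- **`(E, 5) ∈ X11b`** given `r_an(E) = 1` (`hr`; numerics: root number `−1`, `L'(E,1) = 18.4386062…`, `ellrank` = `[1,1,0]`, lane B g15 kit j331690).
[cite: Miller2011LMS, §1] -/
theorem classX11b_five (W : WeierstrassCurve ℚ) (hW : W = ⟨0, 1, 1, -160014291, -1241748681899⟩) [W.IsElliptic] [W.IsGloballyMinimal]
    [Fact (Nat.Prime 5)] (hr : W.analyticRank = 1) : ClassX11b W 5 :=
  ⟨hr, by decide, mult_five W hW, irr_five W hW⟩

/-- **THE DEEP CHILDREN ARE INHABITED AT `(J9t-16o5d269, 5)` modulo two analytic numerics**: the common outer hypotheses of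
`Theorems.NonSurjCornerKolyZDeep` (23046) and `Theorems.NonSurjCornerTwinMuAnDeep` (23047) hold at `E` given `hr : r_an = 1` and
`hSha : ∃ s, shaAn E = s ∧ 0 < ord₅ s` (numerics, kit j331491 ∕ j331690 at 38 digits: `L'(E,1) = 18.4386062…`, generator of height `ĥ = 9.00987811…`
saturated at every prime `≤ 500`, `X = L'(E,1)·#tors²∕(Ω·∏c) = 225.2469529…`, `#Ш(E)_an = X∕ĥ = 25.000000…`). [cite: Zywina2015, Thm. 1.4 (i = 9)]
[cite: GrossZagier1986, Thm. I.6.3 (the L'-value behind #Ш_an)] -/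
theorem deepHypotheses (W : WeierstrassCurve ℚ) (hW : W = ⟨0, 1, 1, -160014291, -1241748681899⟩) [W.IsElliptic]
    [W.IsGloballyMinimal] [Fact (Nat.Prime 5)] (hr : W.analyticRank = 1)
    (hSha : ∃ s : ℚ, shaAn W = (s : ℂ) ∧ 0 < padicValRat 5 s) :
    ClassX11b W 5 ∧ ¬ Surj W 5 ∧ ((5 : ℕ) = 5 ∨ (5 : ℕ) = 7) ∧
      (5 : ℕ) ∣ padicValInt 5 W.minimalDiscriminantInt ∧ ¬ Ram W 5 ∧
      (∃ s : ℚ, shaAn W = (s : ℂ) ∧ 0 < padicValRat 5 s) :=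
  ⟨classX11b_five W hW hr, not_surj_five W hW, Or.inl rfl, dvd_padicValInt_five W hW, not_ram_five W hW, hSha⟩

/-- **What 23047 says at `J9t-16o5d269`** (its inner statement at this pair, for every Heegner field `K` with `L(E^{(d_K)},1) ≠ 0` and every model of
the twist), from the decl BY NAME and the two analytic binders. Nothing is asserted: the decl is a hypothesis. [cite: GreenbergLNM1716, §1 Conj. 1.11 (p. 61) (shape)] -/
theorem twinMuAnDeep_at (h : NonSurjCornerTwinMuAnDeep)
    (W : WeierstrassCurve ℚ) (hW : W = ⟨0, 1, 1, -160014291, -1241748681899⟩) [W.IsElliptic] [W.IsGloballyMinimal]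
    [Fact (Nat.Prime 5)] (hr : W.analyticRank = 1) (hSha : ∃ s : ℚ, shaAn W = (s : ℂ) ∧ 0 < padicValRat 5 s)
    (K : Type) [Field K] [NumberField K] (Wd : WeierstrassCurve ℚ) [Wd.IsElliptic] [Wd.IsGloballyMinimal] (Cd : VariableChange ℚ)
    (hK : IsImaginaryQuadratic K) (hH : SatisfiesHeegnerHypothesis (W.conductorNorm ℤ) K)
    (hL : (W.quadraticTwist (NumberField.discr K : ℚ)).entireLFunction 1 ≠ 0)
    (hCd : Cd • W.quadraticTwist (NumberField.discr K : ℚ) = Wd)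
    (hXd : ClassX11a Wd 5) (hnsd : ¬ Surj Wd 5)
    (hvd : (5 : ℕ) ∣ padicValInt 5 Wd.minimalDiscriminantInt)
    {N : ℕ} [NeZero N] (f : CuspForm (CongruenceSubgroup.Gamma0 N) 2) (hf : ModularForms.IsNewformOf Wd f)
    (ϖ : ℚ) (hϖ : (ϖ : ℝ) * Wd.realPeriodRat = ModularForms.plusPeriod f)
    (a : ℚ_[5]) (L : PowerSeries ℚ_[5])
    (ha₁ : Wd.HasSplitMultiplicativeReductionAtPrime 5 → a = 1) (ha₂ : ¬ Wd.HasSplitMultiplicativeReductionAtPrime 5 → a = -1)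
    (hLf : IsMultPAdicLFunctionOf f 5 a L) :
    ∃ n : ℕ, ‖PowerSeries.coeff n (PowerSeries.C ((ϖ : ℚ) : ℚ_[5]) * L)‖ = 1 := by
  obtain ⟨hX, hns, h57, hv, hram, hs⟩ := deepHypotheses W hW hr hSha
  exact h W 5 hX hns h57 hv hram hs K Wd Cd hK hH hL hCd hXd hnsd hvd f hf ϖ hϖ a L ha₁ ha₂ hLf

end Tm16o5d269

/-! ## Kernel pair facts of `E₀ = [0, -1, 1, -88192781, -8097218415888]` (`J9t-64o155d17`, `j = J₉(-64/155)`, `N = 1625007116555 = 5·17²·19²·31·317²`) at `p = 5` -/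

namespace Tm64o155d17

/-- `Δ(E₀) = -28280360897133857181629721875`. [cite: SilvermanAEC2009, III.1] -/
theorem Δ_eq : (⟨0, -1, 1, -88192781, -8097218415888⟩ : WeierstrassCurve ℤ).Δ = -28280360897133857181629721875 := by
  decide

/-- `Δ(E₀) = -5⁵·17⁶·19⁴·31⁵·317²` (bad primes `5, 17, 19, 31, 317`; `N = 5·17²·19²·31·317²`). [cite: SilvermanAEC2009, VII.5 Prop. 5.1] -/
theorem Δ_eq_factored : (⟨0, -1, 1, -88192781, -8097218415888⟩ : WeierstrassCurve ℤ).Δ =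
    -(5 ^ 5 * 17 ^ 6 * 19 ^ 4 * 31 ^ 5 * 317 ^ 2) := by
  rw [Δ_eq]; norm_num

/-- `c₄(E₀) = 4233253504 = 2⁷·17²·19²·317`. [cite: SilvermanAEC2009, III.1] -/
theorem c₄_eq : (⟨0, -1, 1, -88192781, -8097218415888⟩ : WeierstrassCurve ℤ).c₄ = 4233253504 := by
  decide

/-- `#Ẽ₀(𝔽_2) = 3` (`a_2 = 0`), kernel-decided. [cite: SilvermanAEC2009, V.2] -/
theorem card_F2 : Nat.card (((⟨0, -1, 1, -88192781, -8097218415888⟩ : WeierstrassCurve ℤ).map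
    (Int.castRingHom (ZMod 2))).toAffine.Point) = 3 := by
  rw [@natCard_point_eq_one_add_card (ZMod 2) (@ZMod.instField 2 ⟨by norm_num⟩) _ _ _ (by decide)]
  decide

/-- `E` is an elliptic curve (`Δ ≠ 0`). [cite: SilvermanAEC2009, III.1] -/
theorem isElliptic (W : WeierstrassCurve ℚ) (hW : W = ⟨0, -1, 1, -88192781, -8097218415888⟩) : W.IsElliptic := by
  subst hW; exact isElliptic_of_discOf_ne_zero 0 (-1) 1 (-88192781) (-8097218415888) (by decide +kernel)

/-- The model is GLOBALLY MINIMAL: `|Δ| < 256¹²` and `q¹² ∤ Δ` for every prime `q < 256` (all `ord_q Δ ≤ 6`).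
[cite: SilvermanAEC2009, VII.1 Remark 1.1] -/
theorem isGloballyMinimal (W : WeierstrassCurve ℚ) (hW : W = ⟨0, -1, 1, -88192781, -8097218415888⟩) : W.IsGloballyMinimal := by
  subst hW
  exact CornerSeven.isGloballyMinimal_of_silverman_bounded 0 (-1) 1 (-88192781) (-8097218415888) 256
    (by decide +kernel) (by decide +kernel) (by decide +kernel)

/-- The tree's integral model of `E` is `E₀`. [folklore] -/
theorem integralModelInt_eq (W : WeierstrassCurve ℚ) (hW : W = ⟨0, -1, 1, -88192781, -8097218415888⟩) [W.IsGloballyMinimal] :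
    integralModelInt W = ⟨0, -1, 1, -88192781, -8097218415888⟩ := by
  subst hW; exact integralModelInt_eq_of_map_eq _ (map_mk_int _ _ _ _ _)

/-- `E` as the base change of its integer model. [folklore] -/
theorem eq_baseChange (W : WeierstrassCurve ℚ) (hW : W = ⟨0, -1, 1, -88192781, -8097218415888⟩) :
    W = (⟨0, -1, 1, -88192781, -8097218415888⟩ : WeierstrassCurve ℤ).baseChange ℚ := by
  rw [hW]; ext <;> simp [WeierstrassCurve.baseChange, WeierstrassCurve.map]

/-- **Multiplicative reduction at `5`** (`5 ∣ Δ`, `5 ∤ c₄`). [cite: SilvermanAEC2009, VII.5 Prop. 5.1(b)] -/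
theorem mult_five (W : WeierstrassCurve ℚ) (hW : W = ⟨0, -1, 1, -88192781, -8097218415888⟩) [W.IsElliptic] [W.IsGloballyMinimal]
    [Fact (Nat.Prime 5)] : Mult W 5 :=
  hasMultiplicativeReductionAtPrime_of_intModel (integralModelInt_eq W hW) 5
    (by rw [Δ_eq]; decide) (by rw [c₄_eq]; decide)

/-- `ord₅ Δ_min(E) = 5`. [cite: SilvermanAEC2009, VII.5 Prop. 5.1(b)] -/
theorem padicValInt_five (W : WeierstrassCurve ℚ) (hW : W = ⟨0, -1, 1, -88192781, -8097218415888⟩) [W.IsElliptic] [W.IsGloballyMinimal]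
    [Fact (Nat.Prime 5)] : padicValInt 5 W.minimalDiscriminantInt = 5 := by
  rw [minimalDiscriminantInt_eq (integralModelInt_eq W hW), Δ_eq]
  exact padicValInt_eq_of_dvd_of_not_dvd 5 (by decide) (by decide)

/-- The crux binder **`5 ∣ ord₅ Δ_min(E)`** (`5 = 5·1`). [cite: SilvermanAEC2009, VII.5 Prop. 5.1(b)] -/
theorem dvd_padicValInt_five (W : WeierstrassCurve ℚ) (hW : W = ⟨0, -1, 1, -88192781, -8097218415888⟩) [W.IsElliptic] [W.IsGloballyMinimal]
    [Fact (Nat.Prime 5)] : (5 : ℕ) ∣ padicValInt 5 W.minimalDiscriminantInt := by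
  have h := padicValInt_five W hW
  omega

/-- `ord_{31} Δ_min(E) = 5` (the second multiplicative prime; `5 ∣ 5`: no (ram) witness). [cite: SilvermanAEC2009, VII.5 Prop. 5.1(b)] -/
theorem padicValInt_31 (W : WeierstrassCurve ℚ) (hW : W = ⟨0, -1, 1, -88192781, -8097218415888⟩) [W.IsElliptic] [W.IsGloballyMinimal] :
    padicValInt 31 W.minimalDiscriminantInt = 5 := by
  haveI : Fact (Nat.Prime 31) := ⟨by norm_num⟩
  rw [minimalDiscriminantInt_eq (integralModelInt_eq W hW), Δ_eq]
  exact padicValInt_eq_of_dvd_of_not_dvd 31 (by decide) (by decide)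

/-- **`E[5]` is irreducible**: Frobenius no-root witness at the good prime `ℓ = 2` (`a₂ = 0`, `X² + 2` root-free mod `5`;
Mazur 1978 Prop. 6.3 (1)). [cite: Mazur1978, §6 Prop. 6.3 (1) (p. 153)] -/
theorem irr_five (W : WeierstrassCurve ℚ) (hW : W = ⟨0, -1, 1, -88192781, -8097218415888⟩) [W.IsElliptic] [W.IsGloballyMinimal]
    [Fact (Nat.Prime 5)] : Irr W 5 :=
  haveI : Fact (Nat.Prime 2) := ⟨by norm_num⟩
  hasIrreducibleModPGaloisRep_of_intModel_of_noroot (integralModelInt_eq W hW) 5 2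
    (by decide) (by rw [Δ_eq]; decide) card_F2
    (of_decide_eq_true rfl)

/-- **Every prime of multiplicative reduction of `E` is one of `5`, `31`**: it divides `Δ = -5⁵·17⁶·19⁴·31⁵·317²`, and `17`, `19`, `317` are additive
(`q ∣ Δ`, `q ∣ c₄` at the globally minimal model). [cite: SilvermanAEC2009, VII.5 Prop. 5.1] -/
theorem mem_of_mult (W : WeierstrassCurve ℚ) (hW : W = ⟨0, -1, 1, -88192781, -8097218415888⟩) [W.IsElliptic] [W.IsGloballyMinimal]
    {ℓ : ℕ} [hℓ : Fact ℓ.Prime] (hm : Mult W ℓ) : ℓ = 5 ∨ ℓ = 31 := by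
  have hI := integralModelInt_eq W hW
  have hdvd : (ℓ : ℤ) ∣ (⟨0, -1, 1, -88192781, -8097218415888⟩ : WeierstrassCurve ℤ).Δ := by
    by_contra hnd
    exact (hasGoodReductionAtPrime_of_not_dvd W ℓ (by rwa [minimalDiscriminantInt_eq hI])).not_hasMultiplicativeReduction _ hm
  rw [Δ_eq_factored, Int.dvd_neg, Int.natCast_dvd] at hdvd
  simp only [Int.natAbs_mul, Int.natAbs_pow] at hdvd
  have hp := hℓ.out
  have hadd : ∀ q : ℕ, [Fact q.Prime] → (q : ℤ) ∣ (⟨0, -1, 1, -88192781, -8097218415888⟩ : WeierstrassCurve ℤ).Δ →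
      (q : ℤ) ∣ (⟨0, -1, 1, -88192781, -8097218415888⟩ : WeierstrassCurve ℤ).c₄ → ¬ Mult W q :=
    fun q _ hΔ hc ↦ not_hasMultiplicativeReductionAtPrime_of_intModel_of_dvd_of_dvd hI q hΔ hc
  rcases (Nat.Prime.dvd_mul hp).mp hdvd with hdvd | h317
  · rcases (Nat.Prime.dvd_mul hp).mp hdvd with hdvd | h31
    · rcases (Nat.Prime.dvd_mul hp).mp hdvd with hdvd | h19
      · rcases (Nat.Prime.dvd_mul hp).mp hdvd with hdvd | h17
        · exact Or.inl ((Nat.prime_dvd_prime_iff_eq hp (by norm_num : Nat.Prime 5)).mp (hp.dvd_of_dvd_pow hdvd))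
        · exfalso
          have h' : ℓ = 17 := (Nat.prime_dvd_prime_iff_eq hp (by norm_num : Nat.Prime 17)).mp (hp.dvd_of_dvd_pow h17)
          subst h'
          exact hadd 17 (by rw [Δ_eq]; decide) (by rw [c₄_eq]; decide) hm
      · exfalso
        have h' : ℓ = 19 := (Nat.prime_dvd_prime_iff_eq hp (by norm_num : Nat.Prime 19)).mp (hp.dvd_of_dvd_pow h19)
        subst h'
        exact hadd 19 (by rw [Δ_eq]; decide) (by rw [c₄_eq]; decide) hm
    · exact Or.inr ((Nat.prime_dvd_prime_iff_eq hp (by norm_num : Nat.Prime 31)).mp (hp.dvd_of_dvd_pow h31))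
  · exfalso
    have h' : ℓ = 317 := (Nat.prime_dvd_prime_iff_eq hp (by norm_num : Nat.Prime 317)).mp (hp.dvd_of_dvd_pow h317)
    subst h'
    exact hadd 317 (by rw [Δ_eq]; decide) (by rw [c₄_eq]; decide) hm

/-- The crux binder **no (ram) witness at `5`**: the only multiplicative prime `ℓ ≠ 5` is `31`, with `ord_{31} Δ_min = 5`,
divisible by `5`. [cite: SkinnerUrban2014, Thm. 2 (p. 3), hypothesis (ram)] -/
theorem not_ram_five (W : WeierstrassCurve ℚ) (hW : W = ⟨0, -1, 1, -88192781, -8097218415888⟩) [W.IsElliptic] [W.IsGloballyMinimal]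
    [Fact (Nat.Prime 5)] : ¬ Ram W 5 := by
  rintro ⟨ℓ, hℓ, hne, hm, hv⟩
  rcases mem_of_mult W hW hm with rfl | rfl
  · exact hne rfl
  · apply hv
    have h := padicValInt_31 W hW
    have hF : hℓ = ⟨by norm_num⟩ := Subsingleton.elim _ _
    subst hF
    omega

/-- **`j(E) = J₉(-64/155)`** on Zywina's `X_{G₉}` j-line: `j = c₄³/Δ = −239991783424/89466096875 = t³(t² + 5t + 40)` at `t = -64/155`.
[cite: Zywina2015, §1.3 (J₉) and Thm. 1.4 (arXiv:1508.07660)] -/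
theorem j_eq_J9 (W : WeierstrassCurve ℚ) (hW : W = ⟨0, -1, 1, -88192781, -8097218415888⟩) [W.IsElliptic] :
    W.j = (-64 / 155 : ℚ) ^ 3 * ((-64 / 155 : ℚ) ^ 2 + 5 * (-64 / 155) + 40) := by
  have hW' := eq_baseChange W hW
  subst hW'
  rw [j_baseChange_int, c₄_eq, Δ_eq]; norm_num

/-- **`ρ̄_{E,5}` is NOT onto** — a THEOREM: `E` is non-CM (multiplicative at `5`) and `j(E) = J₉(-64/155)`, so the tree's
`zywina2015_thm14_not_surjective_five_of_j_eq_J9_holds` applies. [cite: Zywina2015, Thm. 1.4 (i = 9) (arXiv:1508.07660)]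
[cite: SilvermanATAEC1994, Thm. II.6.4] -/
theorem not_surj_five (W : WeierstrassCurve ℚ) (hW : W = ⟨0, -1, 1, -88192781, -8097218415888⟩) [W.IsElliptic] [W.IsGloballyMinimal]
    [Fact (Nat.Prime 5)] : ¬ Surj W 5 :=
  zywina2015_thm14_not_surjective_five_of_j_eq_J9_holds W
    (fun hCM ↦ not_hasMultiplicativeReductionAtPrime_of_hasCM W hCM 5 (mult_five W hW)) (-64 / 155) (j_eq_J9 W hW)

/-- **`(E, 5) ∈ X11b`** given `r_an(E) = 1` (`hr`; numerics: root number `−1`, `L'(E,1) = 12.0083108…`, `ellrank` = `[1,1,0]`, lane B g15 kit j331690).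
[cite: Miller2011LMS, §1] -/
theorem classX11b_five (W : WeierstrassCurve ℚ) (hW : W = ⟨0, -1, 1, -88192781, -8097218415888⟩) [W.IsElliptic] [W.IsGloballyMinimal]
    [Fact (Nat.Prime 5)] (hr : W.analyticRank = 1) : ClassX11b W 5 :=
  ⟨hr, by decide, mult_five W hW, irr_five W hW⟩

/-- **THE DEEP CHILDREN ARE INHABITED AT `(J9t-64o155d17, 5)` modulo two analytic numerics**: the common outer hypotheses of
`Theorems.NonSurjCornerKolyZDeep` (23046) and `Theorems.NonSurjCornerTwinMuAnDeep` (23047) hold at `E` given `hr : r_an = 1` and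
`hSha : ∃ s, shaAn E = s ∧ 0 < ord₅ s` (numerics, kit j331491 ∕ j331690 at 38 digits: `L'(E,1) = 12.0083108…`, generator of height `ĥ = 28.6660453…`
saturated at every prime `≤ 500`, `X = L'(E,1)·#tors²∕(Ω·∏c) = 716.6511339…`, `#Ш(E)_an = X∕ĥ = 25.000000…`). [cite: Zywina2015, Thm. 1.4 (i = 9)]
[cite: GrossZagier1986, Thm. I.6.3 (the L'-value behind #Ш_an)] -/
theorem deepHypotheses (W : WeierstrassCurve ℚ) (hW : W = ⟨0, -1, 1, -88192781, -8097218415888⟩) [W.IsElliptic]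
    [W.IsGloballyMinimal] [Fact (Nat.Prime 5)] (hr : W.analyticRank = 1)
    (hSha : ∃ s : ℚ, shaAn W = (s : ℂ) ∧ 0 < padicValRat 5 s) :
    ClassX11b W 5 ∧ ¬ Surj W 5 ∧ ((5 : ℕ) = 5 ∨ (5 : ℕ) = 7) ∧
      (5 : ℕ) ∣ padicValInt 5 W.minimalDiscriminantInt ∧ ¬ Ram W 5 ∧
      (∃ s : ℚ, shaAn W = (s : ℂ) ∧ 0 < padicValRat 5 s) :=
  ⟨classX11b_five W hW hr, not_surj_five W hW, Or.inl rfl, dvd_padicValInt_five W hW, not_ram_five W hW, hSha⟩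

/-- **What 23047 says at `J9t-64o155d17`** (its inner statement at this pair, for every Heegner field `K` with `L(E^{(d_K)},1) ≠ 0` and every model of
the twist), from the decl BY NAME and the two analytic binders. Nothing is asserted: the decl is a hypothesis. [cite: GreenbergLNM1716, §1 Conj. 1.11 (p. 61) (shape)] -/
theorem twinMuAnDeep_at (h : NonSurjCornerTwinMuAnDeep)
    (W : WeierstrassCurve ℚ) (hW : W = ⟨0, -1, 1, -88192781, -8097218415888⟩) [W.IsElliptic] [W.IsGloballyMinimal]
    [Fact (Nat.Prime 5)] (hr : W.analyticRank = 1) (hSha : ∃ s : ℚ, shaAn W = (s : ℂ) ∧ 0 < padicValRat 5 s)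
    (K : Type) [Field K] [NumberField K] (Wd : WeierstrassCurve ℚ) [Wd.IsElliptic] [Wd.IsGloballyMinimal] (Cd : VariableChange ℚ)
    (hK : IsImaginaryQuadratic K) (hH : SatisfiesHeegnerHypothesis (W.conductorNorm ℤ) K)
    (hL : (W.quadraticTwist (NumberField.discr K : ℚ)).entireLFunction 1 ≠ 0)
    (hCd : Cd • W.quadraticTwist (NumberField.discr K : ℚ) = Wd)
    (hXd : ClassX11a Wd 5) (hnsd : ¬ Surj Wd 5)
    (hvd : (5 : ℕ) ∣ padicValInt 5 Wd.minimalDiscriminantInt)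
    {N : ℕ} [NeZero N] (f : CuspForm (CongruenceSubgroup.Gamma0 N) 2) (hf : ModularForms.IsNewformOf Wd f)
    (ϖ : ℚ) (hϖ : (ϖ : ℝ) * Wd.realPeriodRat = ModularForms.plusPeriod f)
    (a : ℚ_[5]) (L : PowerSeries ℚ_[5])
    (ha₁ : Wd.HasSplitMultiplicativeReductionAtPrime 5 → a = 1) (ha₂ : ¬ Wd.HasSplitMultiplicativeReductionAtPrime 5 → a = -1)
    (hLf : IsMultPAdicLFunctionOf f 5 a L) :
    ∃ n : ℕ, ‖PowerSeries.coeff n (PowerSeries.C ((ϖ : ℚ) : ℚ_[5]) * L)‖ = 1 := by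
  obtain ⟨hX, hns, h57, hv, hram, hs⟩ := deepHypotheses W hW hr hSha
  exact h W 5 hX hns h57 hv hram hs K Wd Cd hK hH hL hCd hXd hnsd hvd f hf ϖ hϖ a L ha₁ ha₂ hLf

end Tm64o155d17

end Summit.BirchSwinnertonDyer.BirchSwinnertonDyer.Theorems.CornerFive

end
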